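/-
Origin: expansion seat `planner-pub-hodgecm-mc-axioms-1-g14-0`, handover #W200 2026-08-20T15:53:55Z md5 ecad9817a1a9 (PKG 2aa2dc46325e → ecad9817a1a9; 297 l.; MECHANICAL (iib-R) rewrite v3.1 of the PKG file as it stands (24 token edits; rules R9+R9+R9+R1x2+RX[h₂]x19)) (`HOME/mc/pub-hodgecm-mc-axioms-1-g14/revendor/kit-r55/stage55/HodgeCM/Model/Binders/Real34LetterDecomp.lean`, md5 ecad9817a1a9, 297 lines);
landed by the gen-22 packager (p-g22) in gate run 55 REPLACES the earlier landed copy of `HodgeCM/Model/Binders/Real34LetterDecomp.lean` (seat copy carried the packager Origin header of an earlier run (stripped)).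
-/
/-
Origin: speedrun cell pub-hodgecm, MODEL-CONSTRUCTION sub-cell, unit pub-hodgecm-mc-binder-1-g12 (BINDER PROVER, gen 12; row 17 `real34`:
(W-0-decomp) reduced to pure-tensor letter algebra), seat prover-pub-hodgecm-mc-binder-1-g12-0, 2026-08-20.
Target in PKG: HodgeCM/Model/Binders/Real34LetterDecomp.lean (NEW additive leaf; imports RUN-47 #52 `Binders/Real34BaseWedge` + the vendored tree
modules `Weil1964/AdelicMetaplecticFinRep` (`cosetIndicatorSB`), `Automorphic/FiniteAdeleSchwartzBruhatFourier` (`exists_level_of_mem_schwartzBruhat`)).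
KERNEL ONLY: theorems + 1 def-valued constructor of the census-T record; 0 records, nothing cited, 0 `def … : Prop`; MODEL-N ±0; E unchanged.
Nothing here is a claim of the manuscripts under adjudication.
-/
import Summits.HodgeConjecture.HodgeCM.Model.Binders.Real34BaseWedge
import Literature.NumberTheory.Weil1964.AdelicMetaplecticFinRep
import Literature.NumberTheory.Automorphic.FiniteAdeleSchwartzBruhatFourier

/-!
# (W-0-decomp) from pure-tensor letter algebra

RUN-47 #52 (`Real34CensusSideT.ofLetterWedges`) leaves, besides the (34) core term, the supply and LF-continuity, ONE statement:
(W-0-decomp) `∀ f, core.side.ins f φ₀ ∈ letterWedgeSpan (SGP V c) hV Z₂ Z₃`.  This leaf splits it along the pure-tensor structure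
`𝒮(𝔸^n) = 𝓢(X_∞^n) ⊗ FinSB(n)` (`piSchwartzBruhatEquiv`):

* § 1 **`span_cosetIndicatorSB_eq_top`** — the coset indicators `𝟙_{x + 𝔫𝒪̂^ι}` (`cosetIndicatorSB`) SPAN `FinSB K ι` (a Schwartz–Bruhat function
  on `(𝔸_K^∞)^ι` has a level, tree `exists_level_of_mem_schwartzBruhat`, and a compactly supported level-invariant function is a finite
  combination of coset indicators, tree `exists_eq_sum_indicator_of_invariant`); `mem_span_image2_of_span_eq_top` — bilinear images of two
  spanning families span the span of all values;
* § 2 **`tmul_mem_letterWedgeSpan_of_tensor`** (generic side `S₀`): if `tau34` is a PURE-TENSOR bilinear map — `tau34 (Φ₂ ⊗ F₂) (Φ₃ ⊗ F₃) =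
  T∞ Φ₂ Φ₃ ⊗ Tf F₂ F₃` (`htau`) with the values of `Tf` spanning `FinSB (Fin 6)` (`hTf`) — and the archimedean vector `Ψ∞` is a multiple
  of the letter wedge `T∞ (Z₂ e₀^∨) (Z₃ e₁^∨) − T∞ (Z₂ e₁^∨) (Z₃ e₀^∨)` (`harch`, THE archimedean letter identity), then EVERY `Ψ∞ ⊗ F`,
  `F : FinSB (Fin 6)`, lies in `letterWedgeSpan S₀ hV Z₂ Z₃`;
* § 3 (guarded pins) **`Real34CensusSideT.ofTensorDecomp`** — the census-T record from the (34) core, (W-0-supply), LF-continuity, and the four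
  pure-tensor statements `hins` (every `core.side.ins f φ₀` is `Ψ∞ ⊗ F` for one archimedean `Ψ∞`: binder-2's `insRaw_apply` + `isoOp`
  archimedean), `htau` + `hTf` (pure-tensor shape of `tau34 = cmConjLineTensorFin … isoGL`: tree `seesawConjTensor_apply`,
  `tensorToSum_tmul`, the see-saw element's Weil operator as `A_∞ ⊗ B_f` with `B_f` invertible), `harch` (the letter identity
  `isoOp_∞ (det-letter Gaussian ⊗ vacua) = a • (z₀ ∧ z₁)` in the (34) line frames).

So row 17's residual reads: (34) core TERM ⊕ `hins` ⊕ `htau`/`hTf` ⊕ `harch` ⊕ (W-0-supply) ⊕ `IsLFAction` — each a statement about ONE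
constructed object, none about theta functions or periods.
-/

set_option autoImplicit false

noncomputable section

open MeasureTheory NumberField MulAction IsDedekindDomain
open scoped NumberField
open scoped Matrix InnerProductSpace TensorProduct Classical

attribute [-instance] Quotient.instMeasurableSpace

namespace HodgeCM.Model

open HodgeCM HodgeCM.Universe HodgeCM.Adelic HodgeCM.Model.HypCensus
open HodgeCM.PerL34 HodgeCM.PerL34.Fock HodgeCM.PerL34.Fock.PrintDict HodgeCM.PerL34.Annihilation
open Literature.NumberTheory.Weil1964
open Literature.NumberTheory.Automorphic (piSchwartzBruhat FinSB thinCosetTestFunₗ piSchwartzBruhatEquiv piLevelIdeal indicatorSB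
  finTranslateSB isOpen_piLevelIdeal isCompact_piLevelIdeal)
open Literature.NumberTheory.GelbartRogawski1991.UnitaryDualPair
open Literature.AlgebraicGeometry.HodgeTheory
open Literature.AlgebraicGeometry.ShimuraVarieties
open Literature.NumberTheory.Automorphic.PicardCM
open Literature.NumberTheory.Transcendental (Arapura2012_Cor_15_4_6)
open HodgeCM.Model.ThetaSpace HodgeCM.Model.ArchSideTerm HodgeCM.Model.SupplyInstance HodgeCM.Model.SupplyResidual
open NumberField.SeesawArchTorus (toAdeles printedTorusHom printedTorusHom_apply placesEquiv)
open HodgeCM.PerL34.Fock.LocalFock NumberField.SeesawTorus NumberField.SeesawArchTorus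

/-! ## 1. Coset indicators span `FinSB`; bilinear images of spanning families -/

section FinSBSpan

variable (K : Type) [Field K] [NumberField K] (ι : Type) [Fintype ι]

/-- **The coset indicators `𝟙_{x + 𝔫𝒪̂^ι}` span `FinSB K ι`.** -/
theorem span_cosetIndicatorSB_eq_top :
    Submodule.span ℂ {F : FinSB K ι | ∃ (x : ι → FiniteAdeleRing (𝓞 K) K) (𝔫 : Ideal (𝓞 K)), F = cosetIndicatorSB K ι x 𝔫} = ⊤ := by
  rw [eq_top_iff]
  rintro F -
  obtain ⟨𝔫, -, hinv⟩ := Literature.NumberTheory.Automorphic.exists_level_of_mem_schwartzBruhat (K := K) (ι := ι) F.2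
  obtain ⟨s, hs⟩ := Literature.NumberTheory.Automorphic.exists_eq_sum_indicator_of_invariant (piLevelIdeal K ι 𝔫)
    (isOpen_piLevelIdeal K 𝔫) (f := (F : (ι → FiniteAdeleRing (𝓞 K) K) → ℂ))
    ((Literature.NumberTheory.Automorphic.mem_schwartzBruhat_iff.1 F.2).2) hinv
  have hF : F = ∑ q ∈ s, (F : (ι → FiniteAdeleRing (𝓞 K) K) → ℂ) q.out • cosetIndicatorSB K ι q.out 𝔫 := by
    apply Subtype.ext
    funext x
    have hx := congrFun hs x
    rw [hx, AddSubmonoidClass.coe_finsetSum, Finset.sum_apply]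
    refine Finset.sum_congr rfl fun q _ => ?_
    rw [SetLike.val_smul, Pi.smul_apply, smul_eq_mul, cosetIndicatorSB,
      Literature.NumberTheory.Automorphic.coe_finTranslateSB_apply, Literature.NumberTheory.Automorphic.coe_indicatorSB]
    congr 1
    simp only [Set.indicator_apply, Set.mem_vadd_set_iff_neg_vadd_mem, vadd_eq_add, SetLike.mem_coe]
  rw [hF]
  exact Submodule.sum_mem _ fun q _ => Submodule.smul_mem _ _ (Submodule.subset_span ⟨q.out, 𝔫, rfl⟩)

variable {K ι}

/-- Bilinear images of two spanning families span the span of all values of the bilinear map. -/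
theorem mem_span_image2_of_span_eq_top {M₁ M₂ N : Type*} [AddCommGroup M₁] [Module ℂ M₁] [AddCommGroup M₂] [Module ℂ M₂]
    [AddCommGroup N] [Module ℂ N] (T : M₁ →ₗ[ℂ] M₂ →ₗ[ℂ] N) {s₁ : Set M₁} {s₂ : Set M₂}
    (hs₁ : Submodule.span ℂ s₁ = ⊤) (hs₂ : Submodule.span ℂ s₂ = ⊤) (m₁ : M₁) (m₂ : M₂) :
    T m₁ m₂ ∈ Submodule.span ℂ {n : N | ∃ a ∈ s₁, ∃ b ∈ s₂, n = T a b} := by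
  set P : Submodule ℂ N := Submodule.span ℂ {n : N | ∃ a ∈ s₁, ∃ b ∈ s₂, n = T a b} with hP
  -- first variable: for fixed `b ∈ s₂`, `a ↦ T a b` maps `span s₁ = ⊤` into `P`
  have h1 : ∀ b ∈ s₂, ∀ a : M₁, T a b ∈ P := by
    intro b hb a
    have ha : a ∈ Submodule.span ℂ s₁ := by rw [hs₁]; exact Submodule.mem_top
    induction ha using Submodule.span_induction with
    | mem a ha => exact Submodule.subset_span ⟨a, ha, b, hb, rfl⟩
    | zero => rw [map_zero, LinearMap.zero_apply]; exact P.zero_mem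
    | add a a' _ _ ha ha' => rw [map_add, LinearMap.add_apply]; exact P.add_mem ha ha'
    | smul r a _ ha => rw [map_smul, LinearMap.smul_apply]; exact P.smul_mem r ha
  -- second variable
  have hb : m₂ ∈ Submodule.span ℂ s₂ := by rw [hs₂]; exact Submodule.mem_top
  induction hb using Submodule.span_induction with
  | mem b hb => exact h1 b hb m₁
  | zero => rw [map_zero]; exact P.zero_mem
  | add b b' _ _ hb hb' => rw [map_add]; exact P.add_mem hb hb'
  | smul r b _ hb => rw [map_smul]; exact P.smul_mem r hb

end FinSBSpan

/-! ## 2. Pure tensors `Ψ∞ ⊗ F` in the letter-wedge span -/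

section Tensor

variable (hHD : exists_isReal_hodgeModel) (hI : hodgePQ_independent_of_hodgeModel)
  (h₁ : BallQuotientUniformised)  (h₃ : CMAbelianVarietyRealised)

variable {L : CMField} {ι₁ : L →+* ℂ} {V : HermSpace3 L ι₁} {c : SeesawCtx L} (S₀ : ThetaAdelicSide V c) (hV : IsAnisotropic L V.Hm)

-- `maxHeartbeats 400000` (twice the default, within the package rule): the six rewrites below unify the pin-typed letters
-- `Zₖ (proj a) : 𝓢(((𝕏).J → mixedSpace (𝕏).K), ℂ)` with the `Fin 3 / L⁺`-typed statements by unfolding `thetaSpaceInputIn`.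
set_option maxHeartbeats 400000 in
/-- one generator: `(a • (T∞ (Z₂ e₀^∨) (Z₃ e₁^∨) − T∞ (Z₂ e₁^∨) (Z₃ e₀^∨))) ⊗ Tf 𝟙_{x₂+𝔫₂} 𝟙_{x₃+𝔫₃}` is `a •` the letter wedge at
`(x₂, 𝔫₂), (x₃, 𝔫₃)` when `tau34` has the pure-tensor shape `htau`. -/
theorem smul_wedge_tmul_mem_letterWedgeSpan
    (Z₂ Z₃ : Module.Dual ℂ (thetaSpaceInputIn hHD hI h₁ h₃ S₀ hV).W →ₗ[ℂ]
      SchwartzMap ((thetaSpaceInputIn hHD hI h₁ h₃ S₀ hV).J → mixedEmbedding.mixedSpace (thetaSpaceInputIn hHD hI h₁ h₃ S₀ hV).K) ℂ)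
    (Tinf : SchwartzMap (Fin 3 → mixedEmbedding.mixedSpace ↥(maximalRealSubfield L)) ℂ →
      SchwartzMap (Fin 3 → mixedEmbedding.mixedSpace ↥(maximalRealSubfield L)) ℂ →
        SchwartzMap (Fin 6 → mixedEmbedding.mixedSpace ↥(maximalRealSubfield L)) ℂ)
    (Tf : FinSB ↥(maximalRealSubfield L) (Fin 3) →ₗ[ℂ] FinSB ↥(maximalRealSubfield L) (Fin 3) →ₗ[ℂ] FinSB ↥(maximalRealSubfield L) (Fin 6))
    (htau : ∀ (Φ₂ Φ₃ : SchwartzMap (Fin 3 → mixedEmbedding.mixedSpace ↥(maximalRealSubfield L)) ℂ) (F₂ F₃ : FinSB ↥(maximalRealSubfield L) (Fin 3)),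
      tau34 V c.D (piSchwartzBruhatEquiv ↥(maximalRealSubfield L) (Fin 3) (Φ₂ ⊗ₜ F₂))
          (piSchwartzBruhatEquiv ↥(maximalRealSubfield L) (Fin 3) (Φ₃ ⊗ₜ F₃)) =
        piSchwartzBruhatEquiv ↥(maximalRealSubfield L) (Fin 6) (Tinf Φ₂ Φ₃ ⊗ₜ Tf F₂ F₃))
    (a : ℂ) (x₂ x₃ : Fin 3 → FiniteAdeleRing (𝓞 ↥(maximalRealSubfield L)) ↥(maximalRealSubfield L))
    (𝔫₂ 𝔫₃ : Ideal (𝓞 ↥(maximalRealSubfield L))) :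
    piSchwartzBruhatEquiv ↥(maximalRealSubfield L) (Fin 6)
        ((a • (Tinf (Z₂ (LinearMap.proj 0)) (Z₃ (LinearMap.proj 1)) - Tinf (Z₂ (LinearMap.proj 1)) (Z₃ (LinearMap.proj 0)))) ⊗ₜ
          Tf (cosetIndicatorSB _ _ x₂ 𝔫₂) (cosetIndicatorSB _ _ x₃ 𝔫₃)) ∈ letterWedgeSpan hHD hI h₁ h₃ S₀ hV Z₂ Z₃ := by
  rw [← TensorProduct.smul_tmul', map_smul]
  refine Submodule.smul_mem _ a (Submodule.subset_span ⟨x₂, x₃, 𝔫₂, 𝔫₃, ?_⟩)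
  -- the four frames as pure tensors, then the two wedge summands through `htau`; the letters `Zₖ (proj a)` are typed over the
  -- pin's bundled `(𝕏).J / (𝕏).K` (and its bundled instances), the lemmas over `Fin 3 / L⁺`: `rw` unifies them by unfolding
  -- `thetaSpaceInputIn`, which is what the raised heartbeat budget pays for.
  rw [thinCosetTestFunₗ_eq_tmul_cosetIndicatorSB, thinCosetTestFunₗ_eq_tmul_cosetIndicatorSB,
    thinCosetTestFunₗ_eq_tmul_cosetIndicatorSB, thinCosetTestFunₗ_eq_tmul_cosetIndicatorSB, htau, htau,
    TensorProduct.sub_tmul, map_sub]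

/-- **(W-0-decomp) for pure tensors from the letter algebra.**  Let `tau34` be a pure-tensor bilinear map
(`htau : tau34 (Φ₂ ⊗ F₂) (Φ₃ ⊗ F₃) = T∞ Φ₂ Φ₃ ⊗ Tf F₂ F₃`) whose finite part has spanning values (`hTf`), and let the archimedean vector
`Ψ∞` be a multiple of the letter wedge of the families `Z₂`, `Z₃` (`harch`).  Then `Ψ∞ ⊗ F ∈ letterWedgeSpan S₀ hV Z₂ Z₃` for EVERY finite
part `F` (§ 1: `F` is a combination of `Tf (𝟙_{x₂+𝔫₂𝒪̂³}) (𝟙_{x₃+𝔫₃𝒪̂³})`; `Φ ⊗ 𝟙_{x+𝔫𝒪̂³} = thinCosetTestFunₗ x 𝔫 Φ`). -/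
theorem tmul_mem_letterWedgeSpan_of_tensor
    (Z₂ Z₃ : Module.Dual ℂ (thetaSpaceInputIn hHD hI h₁ h₃ S₀ hV).W →ₗ[ℂ]
      SchwartzMap ((thetaSpaceInputIn hHD hI h₁ h₃ S₀ hV).J → mixedEmbedding.mixedSpace (thetaSpaceInputIn hHD hI h₁ h₃ S₀ hV).K) ℂ)
    (Tinf : SchwartzMap (Fin 3 → mixedEmbedding.mixedSpace ↥(maximalRealSubfield L)) ℂ →
      SchwartzMap (Fin 3 → mixedEmbedding.mixedSpace ↥(maximalRealSubfield L)) ℂ →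
        SchwartzMap (Fin 6 → mixedEmbedding.mixedSpace ↥(maximalRealSubfield L)) ℂ)
    (Tf : FinSB ↥(maximalRealSubfield L) (Fin 3) →ₗ[ℂ] FinSB ↥(maximalRealSubfield L) (Fin 3) →ₗ[ℂ] FinSB ↥(maximalRealSubfield L) (Fin 6))
    (htau : ∀ (Φ₂ Φ₃ : SchwartzMap (Fin 3 → mixedEmbedding.mixedSpace ↥(maximalRealSubfield L)) ℂ) (F₂ F₃ : FinSB ↥(maximalRealSubfield L) (Fin 3)),
      tau34 V c.D (piSchwartzBruhatEquiv ↥(maximalRealSubfield L) (Fin 3) (Φ₂ ⊗ₜ F₂))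
          (piSchwartzBruhatEquiv ↥(maximalRealSubfield L) (Fin 3) (Φ₃ ⊗ₜ F₃)) =
        piSchwartzBruhatEquiv ↥(maximalRealSubfield L) (Fin 6) (Tinf Φ₂ Φ₃ ⊗ₜ Tf F₂ F₃))
    (hTf : Submodule.span ℂ (Set.range fun p : FinSB ↥(maximalRealSubfield L) (Fin 3) × FinSB ↥(maximalRealSubfield L) (Fin 3) =>
      Tf p.1 p.2) = ⊤)
    (Ψinf : SchwartzMap (Fin 6 → mixedEmbedding.mixedSpace ↥(maximalRealSubfield L)) ℂ)
    (harch : ∃ a : ℂ, Ψinf = a • (Tinf (Z₂ (LinearMap.proj 0)) (Z₃ (LinearMap.proj 1)) - Tinf (Z₂ (LinearMap.proj 1)) (Z₃ (LinearMap.proj 0))))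
    (F : FinSB ↥(maximalRealSubfield L) (Fin 6)) :
    piSchwartzBruhatEquiv ↥(maximalRealSubfield L) (Fin 6) (Ψinf ⊗ₜ F) ∈ letterWedgeSpan hHD hI h₁ h₃ S₀ hV Z₂ Z₃ := by
  obtain ⟨a, rfl⟩ := harch
  -- every `F` is a combination of the values `Tf 𝟙_{x₂+𝔫₂} 𝟙_{x₃+𝔫₃}` (§ 1 twice)
  have hF : F ∈ Submodule.span ℂ {G : FinSB ↥(maximalRealSubfield L) (Fin 6) |
      ∃ a ∈ {F : FinSB ↥(maximalRealSubfield L) (Fin 3) | ∃ (x : Fin 3 → FiniteAdeleRing (𝓞 ↥(maximalRealSubfield L)) ↥(maximalRealSubfield L))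
          (𝔫 : Ideal (𝓞 ↥(maximalRealSubfield L))), F = cosetIndicatorSB _ _ x 𝔫},
        ∃ b ∈ {F : FinSB ↥(maximalRealSubfield L) (Fin 3) | ∃ (x : Fin 3 → FiniteAdeleRing (𝓞 ↥(maximalRealSubfield L)) ↥(maximalRealSubfield L))
          (𝔫 : Ideal (𝓞 ↥(maximalRealSubfield L))), F = cosetIndicatorSB _ _ x 𝔫}, G = Tf a b} := by
    have hF' : F ∈ Submodule.span ℂ (Set.range fun p : FinSB ↥(maximalRealSubfield L) (Fin 3) × FinSB ↥(maximalRealSubfield L) (Fin 3) =>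
        Tf p.1 p.2) := by rw [hTf]; exact Submodule.mem_top
    refine Submodule.span_le.2 ?_ hF'
    rintro _ ⟨p, rfl⟩
    exact mem_span_image2_of_span_eq_top Tf (span_cosetIndicatorSB_eq_top _ _) (span_cosetIndicatorSB_eq_top _ _) p.1 p.2
  -- linearity of `G ↦ E₆ (Ψ∞ ⊗ G)`
  induction hF using Submodule.span_induction with
  | mem G hG =>
    obtain ⟨_, ⟨x₂, 𝔫₂, rfl⟩, _, ⟨x₃, 𝔫₃, rfl⟩, rfl⟩ := hG
    exact smul_wedge_tmul_mem_letterWedgeSpan hHD hI h₁ h₃ S₀ hV Z₂ Z₃ Tinf Tf htau a x₂ x₃ 𝔫₂ 𝔫₃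
  | zero => rw [TensorProduct.tmul_zero, map_zero]; exact Submodule.zero_mem _
  | add G G' _ _ hG hG' => rw [TensorProduct.tmul_add, map_add]; exact Submodule.add_mem _ hG hG'
  | smul r G _ hG => rw [TensorProduct.tmul_smul, map_smul]; exact Submodule.smul_mem _ r hG

end Tensor

/-! ## 3. At the guarded pins: the census-T record from the pure-tensor letter algebra -/

namespace Gen12PinsP

variable
  (G : ∀ {L : CMField} {ι₁ : L →+* ℂ} (_V : HermSpace3 L ι₁) (_c : SeesawCtx L), Prop)
  (hG : ∀ {L : CMField} {ι₁ : L →+* ℂ} (V : HermSpace3 L ι₁) (c : SeesawCtx L),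
    G V c → (∀ j, 0 < (ι₁ (dW c.D j)).re) ∨ ∀ j, (ι₁ (dW c.D j)).re < 0)
  (hGR : ∀ {L : CMField} {ι₁ : L →+* ℂ} (V : HermSpace3 L ι₁) (c : SeesawCtx L),
    (cmSplittingDatum (L : Type) finProdFinEquiv (frameD V) (frameD_real V) (frameD_ne V) (dW c.D) (dW_real c.D)
      (dW_ne c.D)).CompatibleSplitting)
  (η : ∀ {L : CMField} {ι₁ : L →+* ℂ} (V : HermSpace3 L ι₁) (c : SeesawCtx L),
    CMAdelic (L : Type) (frameD V) × CMAdelic (L : Type) (dW c.D) →* ℂˣ)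
  (hη : ∀ {L : CMField} {ι₁ : L →+* ℂ} (V : HermSpace3 L ι₁) (c : SeesawCtx L),
    ∀ γU ∈ CMRat (L : Type) (frameD V), ∀ γ ∈ CMRat (L : Type) (dW c.D), η V c (γU, γ) = 1)
  (hηc : ∀ {L : CMField} {ι₁ : L →+* ℂ} (V : HermSpace3 L ι₁) (c : SeesawCtx L), Continuous fun p => ((η V c p : ℂˣ) : ℂ))
  (hGR₀ : ∀ {L : CMField} {ι₁ : L →+* ℂ} (V : HermSpace3 L ι₁) (c : SeesawCtx L),
    (cmSplittingDatum (L : Type) (e₁) (frameD V) (frameD_real V) (frameD_ne V) (lineVec (L : Type) (dW c.D 0))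
      (fun _ => dW_real c.D 0) (fun _ => dW_ne c.D 0)).CompatibleSplitting)
  (hGR₁ : ∀ {L : CMField} {ι₁ : L →+* ℂ} (V : HermSpace3 L ι₁) (c : SeesawCtx L),
    (cmSplittingDatum (L : Type) (e₁) (frameD V) (frameD_real V) (frameD_ne V) (lineVec (L : Type) (dW c.D 1))
      (fun _ => dW_real c.D 1) (fun _ => dW_ne c.D 1)).CompatibleSplitting)
  (hGR₂ : ∀ {L : CMField} {ι₁ : L →+* ℂ} (V : HermSpace3 L ι₁) (c : SeesawCtx L),
    (cmSplittingDatum (L : Type) (e₁) (frameD V) (frameD_real V) (frameD_ne V) (lineVec (L : Type) (dW' c.D 0))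
      (fun _ => dW'_real c.D 0) (fun _ => dW'_ne c.D 0)).CompatibleSplitting)
  (hGR₃ : ∀ {L : CMField} {ι₁ : L →+* ℂ} (V : HermSpace3 L ι₁) (c : SeesawCtx L),
    (cmSplittingDatum (L : Type) (e₁) (frameD V) (frameD_real V) (frameD_ne V) (lineVec (L : Type) (dW' c.D 1))
      (fun _ => dW'_real c.D 1) (fun _ => dW'_ne c.D 1)).CompatibleSplitting)
  (AG : ∀ {L : CMField} {ι₁ : L →+* ℂ} (V : HermSpace3 L ι₁) (c : SeesawCtx L), G V c → ∀ k : Fin 4,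
    ArchLineInput V (lineRepD V c.D (hGR V c) (hGR₀ V c) (hGR₁ V c) (hGR₂ V c) (hGR₃ V c) (η V c) k))

variable (hHD : exists_isReal_hodgeModel) (hI : hodgePQ_independent_of_hodgeModel)
  (h₁ : BallQuotientUniformised)  (h₃ : CMAbelianVarietyRealised)
  (h : Bool) (hA : Arapura2012_Cor_15_4_6) (μ : ∀ {L : CMField}, SeesawCtx L → Fin 4 → InfinitePlace L → ℤ)

section Context34

variable {L : CMField} {ι₁ : L →+* ℂ} (V : HermSpace3 L ι₁) (c : SeesawCtx L) (hV : IsAnisotropic L V.Hm)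

/-- **`Real34CensusSideT` FROM THE PURE-TENSOR LETTER ALGEBRA.**  Inputs: binder-2's (34) census core; the archimedean letter families
`Z₂ Z₃` of lines `2`, `3`; LF-continuity of the two (34) pair actions; (W-0-supply) (carch-1's At-tower); and four pure-tensor statements —
`hins` (every inserted base vector is `Ψ∞ ⊗ F` for ONE archimedean vector `Ψ∞`), `htau` (pure-tensor shape of `tau34`), `hTf` (its finite
part has spanning values), `harch` (`Ψ∞` is a multiple of the letter wedge `T∞ (Z₂ e₀^∨) (Z₃ e₁^∨) − T∞ (Z₂ e₁^∨) (Z₃ e₀^∨)`). -/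
def Real34CensusSideT.ofTensorDecomp (hW : IsAnisotropic L c.D.gramW)
    (core : HypCoreW ((Gen12Pins.Wg @hGR @η @hη @hηc @Gen12Pins.τSyl @Gen12Pins.TSyl @Gen12Pins.hTSyl) V c) c.D.jT₃₄ (fun w => -μ c 2 w) (fun w => -μ c 3 w))
    (Z₂ Z₃ : Module.Dual ℂ (thetaSpaceInputIn hHD hI h₁ h₃ ((SInstance.SGP @G @hG @hGR @η @hη @hηc @hGR₀ @hGR₁ @hGR₂ @hGR₃ @AG) V c) hV).W →ₗ[ℂ]
      SchwartzMap ((thetaSpaceInputIn hHD hI h₁ h₃ ((SInstance.SGP @G @hG @hGR @η @hη @hηc @hGR₀ @hGR₁ @hGR₂ @hGR₃ @AG) V c) hV).J →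
        mixedEmbedding.mixedSpace (thetaSpaceInputIn hHD hI h₁ h₃ ((SInstance.SGP @G @hG @hGR @η @hη @hηc @hGR₀ @hGR₁ @hGR₂ @hGR₃ @AG) V c) hV).K) ℂ)
    (hLF₂ : ((thetaSpaceInputIn hHD hI h₁ h₃ ((SInstance.SGP @G @hG @hGR @η @hη @hηc @hGR₀ @hGR₁ @hGR₂ @hGR₃ @AG) V c) hV).P 2).IsLFAction)
    (hLF₃ : ((thetaSpaceInputIn hHD hI h₁ h₃ ((SInstance.SGP @G @hG @hGR @η @hη @hηc @hGR₀ @hGR₁ @hGR₂ @hGR₃ @AG) V c) hV).P 3).IsLFAction)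
    (hsupply : ∀ (x₂ x₃ : Fin 3 → FiniteAdeleRing (𝓞 ↥(maximalRealSubfield L)) ↥(maximalRealSubfield L))
        (𝔫₂ 𝔫₃ : Ideal (𝓞 ↥(maximalRealSubfield L))),
      ∃ (B₂ : ArchKTypeDataAt (thetaSpaceInputIn hHD hI h₁ h₃ ((SInstance.SGP @G @hG @hGR @η @hη @hηc @hGR₀ @hGR₁ @hGR₂ @hGR₃ @AG) V c) hV) 2 x₂ 𝔫₂)
        (B₃ : ArchKTypeDataAt (thetaSpaceInputIn hHD hI h₁ h₃ ((SInstance.SGP @G @hG @hGR @η @hη @hηc @hGR₀ @hGR₁ @hGR₂ @hGR₃ @AG) V c) hV) 3 x₃ 𝔫₃),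
        B₃.Γ₀ = B₂.Γ₀ ∧ B₂.Φarch = Z₂ ∧ B₃.Φarch = Z₃ ∧
          B₂.IsWeaklyPDiff BallForms.expP ∧
          (∀ p : Fin 2, B₂.IsPMinusKilledAlong BallForms.expP (-Complex.I • (Pi.single p 1 : Fin 2 → ℂ))) ∧
          B₃.IsWeaklyPDiff BallForms.expP ∧
          (∀ p : Fin 2, B₃.IsPMinusKilledAlong BallForms.expP (-Complex.I • (Pi.single p 1 : Fin 2 → ℂ))))
    (Tinf : SchwartzMap (Fin 3 → mixedEmbedding.mixedSpace ↥(maximalRealSubfield L)) ℂ →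
      SchwartzMap (Fin 3 → mixedEmbedding.mixedSpace ↥(maximalRealSubfield L)) ℂ →
        SchwartzMap (Fin 6 → mixedEmbedding.mixedSpace ↥(maximalRealSubfield L)) ℂ)
    (Tf : FinSB ↥(maximalRealSubfield L) (Fin 3) →ₗ[ℂ] FinSB ↥(maximalRealSubfield L) (Fin 3) →ₗ[ℂ] FinSB ↥(maximalRealSubfield L) (Fin 6))
    (htau : ∀ (Φ₂ Φ₃ : SchwartzMap (Fin 3 → mixedEmbedding.mixedSpace ↥(maximalRealSubfield L)) ℂ) (F₂ F₃ : FinSB ↥(maximalRealSubfield L) (Fin 3)),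
      tau34 V c.D (piSchwartzBruhatEquiv ↥(maximalRealSubfield L) (Fin 3) (Φ₂ ⊗ₜ F₂))
          (piSchwartzBruhatEquiv ↥(maximalRealSubfield L) (Fin 3) (Φ₃ ⊗ₜ F₃)) =
        piSchwartzBruhatEquiv ↥(maximalRealSubfield L) (Fin 6) (Tinf Φ₂ Φ₃ ⊗ₜ Tf F₂ F₃))
    (hTf : Submodule.span ℂ (Set.range fun p : FinSB ↥(maximalRealSubfield L) (Fin 3) × FinSB ↥(maximalRealSubfield L) (Fin 3) =>
      Tf p.1 p.2) = ⊤)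
    (Ψinf : SchwartzMap (Fin 6 → mixedEmbedding.mixedSpace ↥(maximalRealSubfield L)) ℂ)
    (harch : ∃ a : ℂ, Ψinf = a • (Tinf (Z₂ (LinearMap.proj 0)) (Z₃ (LinearMap.proj 1)) - Tinf (Z₂ (LinearMap.proj 1)) (Z₃ (LinearMap.proj 0))))
    (hins : letI := core.decEq
      ∀ f : core.side.FinIdx, ∃ F : FinSB ↥(maximalRealSubfield L) (Fin 6),
        (core.side.ins f (printPlaces (InfinitePlace (L : Type)) core.kind core.lam core.hlam
            (pinnedVacs core.kind (fun w => -μ c 2 w) (fun w => -μ c 3 w))).φ₀ : piSchwartzBruhat (↥(maximalRealSubfield L)) (Fin 6)) =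
          piSchwartzBruhatEquiv ↥(maximalRealSubfield L) (Fin 6) (Ψinf ⊗ₜ F)) :
    Real34CensusSideT @G @hG @hGR @η @hη @hηc @hGR₀ @hGR₁ @hGR₂ @hGR₃ @AG hHD hI h₁ h₃ h hA @μ V c hV :=
  Real34CensusSideT.ofLetterWedges @G @hG @hGR @η @hη @hηc @hGR₀ @hGR₁ @hGR₂ @hGR₃ @AG hHD hI h₁ h₃ h hA @μ V c hV hW core Z₂ Z₃
    hLF₂ hLF₃ hsupply (by
      letI := core.decEq
      intro f
      obtain ⟨F, hF⟩ := hins f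
      rw [hF]
      exact tmul_mem_letterWedgeSpan_of_tensor hHD hI h₁ h₃ _ hV Z₂ Z₃ Tinf Tf htau hTf Ψinf harch F)

end Context34

end Gen12PinsP

end HodgeCM.Model

end
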